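import Literature.NumberTheory.EllipticCurves.GreenbergStrictSelmerDualProofs
import Literature.NumberTheory.EllipticCurves.KatoFineSelmerDualMuProofs
import Literature.NumberTheory.EllipticCurves.IwasawaModuleFinitePadicIntProofs
import HarnessLib

/-!
# The dual `X_L = Hom(Sel^{str}_L(K_∞, E[p^∞]), ℚ/ℤ)` of a Greenberg strict Selmer group: finite generation from
# `Sel[𝔪]`, `X_L/(p)X_L` finite ⟸ `Sel[p]` finite, and then **`Λ`-TORSION with `μ = 0`, finitely generated over `ℤ_p`**
# (Pontryagin algebra + Nakayama, proved; no named fact)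

Second sibling proof file of `GreenbergStrictSelmerDualProofs` (structure `WeierstrassCurve.GreenbergStrictSelmerDualData W κ γ L`,
construction `greenbergStrictSelmerDualData`), WORD FOR WORD the tree's `KatoFineSelmerDualMuProofs` (the fine Selmer group =
all-strict data) with `fineSelmerInfty ↦ GreenbergSelmer.strictSelmerInfty κ E[p^∞] L`:

* `exists_pow_smul_greenbergStrictSelmerInfty_eq_zero` — `Sel^{str}_L(K_∞, E[p^∞])` is `p`-primary;
* `GreenbergStrictSelmerDualData.isDualPair` — every dual datum is an `IwasawaDual.IsDualPair` for `ψ = conj_γ − 1`;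
* `.module_finite_of_finite` / `.module_finite_of_finite_pTorsion` — **`X_L` is finitely generated over `Λ` once
  `Sel[𝔪] = {s | p·s = 0, conj_γ s = s}` (a fortiori `Sel[p]`) is finite** (Nakayama for duals, `IsDualPair.module_finite`);
* `.finite_quotient_augIdealP_of_finite_pTorsion` — `Sel[p]` finite ⟹ `X_L/(p)X_L` finite;
* `.isTorsion_of_finite_pTorsion`, `.muInvariant_eq_zero_of_finite_pTorsion`, `.moduleFinite_padicInt_of_finite_pTorsion`,
  `.finite_torsion_mu_of_finite_pTorsion` — **`Sel^{str}_L(K_∞, E[p^∞])[p]` finite ⟹ `X_L` is finitely generated over `Λ`,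
  `Λ`-TORSION, `μ(X_L) = 0`, and finitely generated over `ℤ_p`** (tree `isTorsion_of_finite_quotient_augIdealP`,
  `muInvariant_eq_zero_of_finite_quotient_augIdealP`, `moduleFinite_padicInt_of_finite_quotient_augIdealP`).

USE (why this is filed now).  The registered line `kato-determinant-greenberg-two` of crux `OrdLambdaHalfAtTwo`
(item stmt-BirchSwinnertonDyer-19556, skeleton `Cruxes/OrdLambdaHalfAtTwo/Lines/kato_determinant_greenberg_two.lean`) needs, as the only
research clause (B2) of its supply stub `stub_greenbergSupplyAtTwo`, that the dual `X_Gr` of the Greenberg (strict at `w`, relaxed at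
`w̄`) Selmer group of `E[2^∞]` over the cyclotomic `ℤ₂`-tower of a Greenberg field `K` be **finitely generated and `Λ`-torsion**.  By
`finite_torsion_mu_of_finite_pTorsion` below this is implied by the RESIDUAL statement «`Sel_Gr(K_∞, E[2^∞])[2]` is finite» — the
currency in which the card's road (dévissage along `0 → 𝔽₂ → E[2] → 𝔽₂ → 0` to `GL(1)/K` objects + Ferrero–Washington) operates.

HONEST FRAMING: theorems only; nothing asserted about any particular Selmer group; BSD is not proved by any of this.

References: R. Greenberg, LNM 1716 (1999), §1 p. 60 ("`X/𝔪X` is finite … Nakayama") [GreenbergLNM1716]; R. Greenberg, Adv.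
Stud. Pure Math. 17 (1989) §1 [Greenberg1989]; S. Lang, *Cyclotomic Fields I and II*, Ch. 5 §1; L. Washington, §13.2 [Washington1997].
-/

noncomputable section

open scoped Classical

open Literature.NumberTheory.EllipticCurves Literature.NumberTheory.EllipticCurves.IwasawaAlgebra
  Literature.NumberTheory.EllipticCurves.IwasawaModuleFinitePadicInt
  Literature.NumberTheory.EllipticCurves.IwasawaDual

universe u

namespace WeierstrassCurve

variable {K : Type u} [Field K] [NumberField K] {W : WeierstrassCurve K} {p : ℕ} [Fact p.Prime]
  {κ : ZpExtension K p} {L : GreenbergSelmer.Data K (↥(W.geomPrimaryTorsion p)) p}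

/-- Every class of `Sel^{str}_L(K_∞, E[p^∞])` is killed by a power of `p` (it is a class of `H¹(K_∞, E[p^∞])`,
`exists_pow_smul_subgroupH1_ker_eq_zero`). [cite: GreenbergLNM1716, §1 (after Conj. 1.3)] -/
theorem exists_pow_smul_greenbergStrictSelmerInfty_eq_zero
    (s : GreenbergSelmer.strictSelmerInfty κ (↥(W.geomPrimaryTorsion p)) L) : ∃ k : ℕ, p ^ k • s = 0 := by
  obtain ⟨k, hk⟩ := W.exists_pow_smul_subgroupH1_ker_eq_zero κ (s : W.subgroupH1 p κ.kerSubgroup)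
  exact ⟨k, Subtype.ext (by rw [AddSubgroupClass.coe_nsmul]; exact hk)⟩

namespace GreenbergStrictSelmerDualData

variable {γ : Field.absoluteGaloisGroup K} (Y : W.GreenbergStrictSelmerDualData κ γ L)

/-- Every Greenberg strict dual datum is a dual pair for `ψ = conj_γ − 1` on `Sel^{str}_L` (the fields of the structure +
`isLocNil_conjGreenbergStrictSelmerInfty_sub_one`). [cite: GreenbergLNM1716, §1 (after Conj. 1.3)] -/
theorem isDualPair (hγ : κ.IsTopGenerator γ) :
    IwasawaDual.IsDualPair p (W.conjGreenbergStrictSelmerInfty κ γ L - 1) Y.toDual where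
  bijective := Y.bijective
  T_smul x s := by
    rw [Y.toDual_T_smul, IwasawaDual.End_sub_apply, AddMonoid.End.one_apply, map_sub]
    rfl
  C_smul c x s k hk := Y.toDual_C_smul c x s k hk
  locNil := W.isLocNil_conjGreenbergStrictSelmerInfty_sub_one κ L hγ

/-- **`X_L` is finitely generated over `Λ` as soon as `Sel^{str}_L[𝔪] = {s | p s = 0, conj_γ s = s}` is finite** (Nakayama for
duals, `IsDualPair.module_finite`). [cite: GreenbergLNM1716, §1 p. 60 (after Conj. 1.3)] -/
theorem module_finite_of_finite (hγ : κ.IsTopGenerator γ)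
    (hfin : Set.Finite {s : GreenbergSelmer.strictSelmerInfty κ (↥(W.geomPrimaryTorsion p)) L |
      p • s = 0 ∧ W.conjH1 p κ.kerSubgroup γ (s : W.subgroupH1 p κ.kerSubgroup) = s}) :
    Module.Finite (IwasawaAlgebra p) Y.X := by
  refine (Y.isDualPair hγ).module_finite ?_
  refine hfin.subset fun s hs ↦ ?_
  obtain ⟨hs1, hs2⟩ := hs
  rw [pow_one] at hs1 hs2
  refine ⟨hs1, ?_⟩
  rw [IwasawaDual.End_sub_apply, AddMonoid.End.one_apply, sub_eq_zero] at hs2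
  exact congrArg
    (fun z : GreenbergSelmer.strictSelmerInfty κ (↥(W.geomPrimaryTorsion p)) L ↦ (z : W.subgroupH1 p κ.kerSubgroup)) hs2

/-- In particular `X_L` is finitely generated over `Λ` once `Sel^{str}_L(K_∞, E[p^∞])[p]` is finite.
[cite: GreenbergLNM1716, §1 p. 60 (after Conj. 1.3)] -/
theorem module_finite_of_finite_pTorsion (hγ : κ.IsTopGenerator γ)
    (hfin : Set.Finite {s : GreenbergSelmer.strictSelmerInfty κ (↥(W.geomPrimaryTorsion p)) L | p • s = 0}) :
    Module.Finite (IwasawaAlgebra p) Y.X :=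
  Y.module_finite_of_finite hγ (hfin.subset fun _ hs ↦ hs.1)

/-- **`Sel^{str}_L(K_∞, E[p^∞])[p]` finite ⟹ `X_L/(p)X_L` finite** (`IwasawaDual.finite_quotient_pSmul_of_finite_pTorsion` for the
datum `Y`; `(p) = augIdealP p`). [cite: GreenbergLNM1716, §1 p. 60 (after Conj. 1.3)] -/
theorem finite_quotient_augIdealP_of_finite_pTorsion
    (hfin : Set.Finite {s : GreenbergSelmer.strictSelmerInfty κ (↥(W.geomPrimaryTorsion p)) L | p • s = 0}) :
    Finite (Y.X ⧸ (IwasawaAlgebra.augIdealP p • (⊤ : Submodule (IwasawaAlgebra p) Y.X))) :=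
  IwasawaDual.finite_quotient_pSmul_of_finite_pTorsion Y.bijective Y.toDual_C_smul
    exists_pow_smul_greenbergStrictSelmerInfty_eq_zero hfin

/-- **`Sel^{str}_L(K_∞, E[p^∞])[p]` finite ⟹ `X_L` is `Λ`-TORSION** (finite generation by Nakayama, then the tree's
`isTorsion_of_finite_quotient_augIdealP`: a finitely generated `Λ`-module with `X/(p)X` finite is torsion).
[cite: GreenbergLNM1716, §1 p. 60 (after Conj. 1.3)] [cite: Washington1997, §13.2] -/
theorem isTorsion_of_finite_pTorsion (hγ : κ.IsTopGenerator γ)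
    (hfin : Set.Finite {s : GreenbergSelmer.strictSelmerInfty κ (↥(W.geomPrimaryTorsion p)) L | p • s = 0}) :
    Module.IsTorsion (IwasawaAlgebra p) Y.X := by
  haveI := Y.module_finite_of_finite_pTorsion hγ hfin
  exact isTorsion_of_finite_quotient_augIdealP p Y.X (Y.finite_quotient_augIdealP_of_finite_pTorsion hfin)

/-- **`Sel^{str}_L(K_∞, E[p^∞])[p]` finite ⟹ `μ(X_L) = 0`** (tree `muInvariant_eq_zero_of_finite_quotient_augIdealP`).
[cite: GreenbergLNM1716, §1 p. 60 (after Conj. 1.3)] [cite: Washington1997, §13.2] -/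
theorem muInvariant_eq_zero_of_finite_pTorsion (hγ : κ.IsTopGenerator γ)
    (hfin : Set.Finite {s : GreenbergSelmer.strictSelmerInfty κ (↥(W.geomPrimaryTorsion p)) L | p • s = 0}) :
    muInvariant p Y.X = 0 := by
  haveI := Y.module_finite_of_finite_pTorsion hγ hfin
  exact muInvariant_eq_zero_of_finite_quotient_augIdealP p Y.X (Y.isTorsion_of_finite_pTorsion hγ hfin)
    (Y.finite_quotient_augIdealP_of_finite_pTorsion hfin)

/-- **`Sel^{str}_L(K_∞, E[p^∞])[p]` finite ⟹ `X_L` is finitely generated over `ℤ_p`** (tree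
`moduleFinite_padicInt_of_finite_quotient_augIdealP`). [cite: GreenbergLNM1716, §1 p. 60 (after Conj. 1.3)] [cite: Washington1997, §13.2] -/
theorem moduleFinite_padicInt_of_finite_pTorsion (hγ : κ.IsTopGenerator γ)
    (hfin : Set.Finite {s : GreenbergSelmer.strictSelmerInfty κ (↥(W.geomPrimaryTorsion p)) L | p • s = 0}) :
    Module.Finite ℤ_[p] (RestrictScalars ℤ_[p] (IwasawaAlgebra p) Y.X) := by
  haveI := Y.module_finite_of_finite_pTorsion hγ hfin
  exact moduleFinite_padicInt_of_finite_quotient_augIdealP p Y.X (Y.finite_quotient_augIdealP_of_finite_pTorsion hfin)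

/-- **The residual-finiteness package**: `Sel^{str}_L(K_∞, E[p^∞])[p]` finite ⟹ `X_L` is finitely generated over `Λ`,
`Λ`-torsion, and has `μ = 0` — exactly the shape «`Module.Finite Λ X_Gr ∧ Module.IsTorsion Λ X_Gr`» (plus `μ = 0`) that the
cotorsion clause (B2) of the kato-determinant line's supply stub asks for. [cite: GreenbergLNM1716, §1 p. 60 (after Conj. 1.3)]
[cite: Washington1997, §13.2] -/
theorem finite_torsion_mu_of_finite_pTorsion (hγ : κ.IsTopGenerator γ)
    (hfin : Set.Finite {s : GreenbergSelmer.strictSelmerInfty κ (↥(W.geomPrimaryTorsion p)) L | p • s = 0}) :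
    Module.Finite (IwasawaAlgebra p) Y.X ∧ Module.IsTorsion (IwasawaAlgebra p) Y.X ∧ muInvariant p Y.X = 0 :=
  ⟨Y.module_finite_of_finite_pTorsion hγ hfin, Y.isTorsion_of_finite_pTorsion hγ hfin,
    Y.muInvariant_eq_zero_of_finite_pTorsion hγ hfin⟩

end GreenbergStrictSelmerDualData

end WeierstrassCurve

end
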